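import Summits.BirchSwinnertonDyer.Rank1Residual.X2.RankOneParitySqueeze
import Summits.BirchSwinnertonDyer.Rank1Residual.X2.RankOneNonsplitCertificate
import Literature.NumberTheory.EllipticCurves.SteinWuthrich2013.SplitMultCanonicalHolds
import Literature.NumberTheory.EllipticCurves.SteinWuthrich2013.NonsplitMultCanonicalHolds
import HarnessLib

/-!
# Row B11 ∩ NON-SPLIT, λ_an = 3 (both ψ-parities): the KELLER–YIN-FREE per-pair road
# «route P ∘ orderOne» as ONE composed door — Mazur's main conjecture AND `BSD(E,p)` at an X2c pair
# from `(μ_an, λ_an) = (0, 3)`, a certified lower bound on `ord_p Reg_p` of THE Stein–Wuthrich §4.2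
# height, the Tamagawa/torsion inequality, and `ord_{T=0} L_p = 1`
# (cell `bsd-eis`, seat `bsd-eis-k5-c4` gen 9; route `EisensteinPrimes`, crux 4 `BSDpOnCellC` =
# stmt-BirchSwinnertonDyer-19034; THEOREMS ONLY — no definition, no new named fact)

HONEST FRAMING (FULL-BSD rank-≤1 programme D-0033, cell `bsd-eis`, home `run/shared/lean/pub/bsd-eis/`;
row B11 = X2c: `r_an = 1`, `p` odd, `p ‖ N`, `E[p]` reducible; O9 atlas `class-closure/O9/E2-hypotheses.tsv`).
Per-pair CONDITIONAL theorems: the class-level inputs are the tree's registered PUBLISHED facts BY NAME,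
the per-pair inputs are instrument READINGS. Nothing is booked here and no label or count moves (the
referee's word at an offer does that); X2c stays CONSTRUCTION-SHAPED as a class (crux 4 is OPEN and its
four registered stubs are untouched); BSD is proved for no curve by this file unconditionally.

WHY THIS FILE. The seat's λ-minimal road (`X2.bsdp_of_cellC_of_not_split_of_lamMin`, k5-c4 g8, 98 window
displays + 2 124 class-wide cells, referee B R723 `T-EISX2LM1`) and the ψ-odd orderOne road
(`X2.bsdp_of_cellC_of_not_split_of_gvPar_of_orderOne_of_facts`) leave the **ψ-EVEN λ-EXCESS** non-split
cells without a Keller–Yin-free road (k5-c4 MEMO-6 §6 V9: «(i) `X2.cellC_mazurMainConjectureAt_of_routeP`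
… needs p-adic HEIGHT certificates at `p ‖ N` (SW13 §4.2 algorithm) — an engine this cell does not have
yet»). Gen 9 built that engine (engine H = the tree's `heightFourOneCoord` transcribed into PARI
`p`-adics, agreeing with PARI's canonical `ellpadicheight·[1,−s₂]` to `3^35` on every smoke cell) and
this file states the road it feeds as ONE door in the grammar of the booked roads:

* b2b gen 5's **route P at rank one** (`X2.cellC_mazurMainConjectureAt_of_routeP`,
  `X2/RankOneParitySqueeze.lean`): `μ_an = 0`, `λ_an = 3` (non-split: no trivial zero), Kato–Wuthrich
  divisibility (Wuthrich 2014 Thm. 16) + Greenberg's parity `corank Sel ≡ λ(f_E) (mod 2)` (LNM 1716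
  Prop. 3.10) squeeze `λ(f_E) ∈ {1, 3}`; `λ(f_E) = 1` would make THE §4.2 height non-degenerate with
  `[T¹]f_E ∈ ℤ_pˣ` and Stein–Wuthrich Thm. 6.1 (3) would force `1 + 2·ord_p #tors ≥ v + ord_p ∏c_ℓ` for
  any certified `v ≤ ord_p Reg_p` — so the READ inequality `1 + 2·ord_p #tors < v + ord_p ∏c_ℓ` gives
  `λ(f_E) = 3` and Mazur's main conjecture at the pair;
* b2b gen 19's `X2.bsdp_of_cellC_of_not_split_of_mazurMainConjectureAt_of_orderOne`: MC at the pair +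
  `ord_{T=0} L_p = 1` for THE non-split Mazur–Tate–Teitelbaum function ⟹ Schneider for THE §4.2 height
  (Stein–Wuthrich Thm. 6.1 (2)) ⟹ `BSD(E,p)` (Disegni 2020 Thm. 4 + Stein–Wuthrich Thm. 6.1 (3)).
The existence facts `exists_isSplitMultCanonical` / `exists_isMultCanonical` (THE §4.2 heights exist) are
TREE THEOREMS (`…_holds`, k5-c4 g3 / b2b) and are discharged inside.

* §1 `mazurMC_and_bsdp_of_cellC_of_not_split_of_routeP_of_orderOne` — the door: `CellC W p ∧ ¬split`,
  READ `hμ0 : AnalyticMuLE W p 0`, `hlam3 : AnalyticLambdaEq W p 3`, `hv` (every canonical §4.2 height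
  datum with `Reg_p ≠ 0` has `v ≤ ord_p Reg_p`), `hb : 1 + 2·ord_p #E(ℚ)_tors < v + ord_p ∏c_ℓ`,
  `hordL : ord_{T=0} L = 1` ⟹ `X2.MazurMainConjectureAt W p ∧ BSDp W p`.
* §2 `…_of_not_dvd_torsionOrder` — the same with `p ∤ #E(ℚ)_tors` and `hb : 2 ≤ v + ord_p ∏c_ℓ`
  (the shape of every B11 cell of record: no rational `p`-torsion at a reducible `p ‖ N` with `r = 1`
  is the census norm, `tors` column of `B11NS-ALL-rows.tsv`).
* §3 (gen 9, second landing) `mazurMC_and_bsdp_of_cellC_of_not_split_of_routeP_of_regulator` (+ the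
  `p ∤ #tors` form) — the REGULATOR ROAD: the same conclusion with the single height reading
  `Reg_p ≠ 0 ∧ v ≤ ord_p Reg_p` in place of `hv` + `hordL` (under the main conjecture `ord_{T=0} L_p = 1`
  and Schneider are equivalent, `X2.orderOne_iff_schneider_of_mazurMainConjectureAt_nonsplit`; O9's
  `X2.bsdp_of_cellC_of_not_split_of_mazurMainConjectureAt_of_schneider` closes) — for the cells whose
  `ord_{T=0}` certificate is inconclusive at every computed level.
Class-level binders, all REGISTERED Literature facts BY NAME: `hDis` Disegni 2020 Thm. 4, `hWu` Wuthrich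
2014 Thm. 16, `hJs`/`hJn` Stein–Wuthrich 2013 Thm. 6.1, `h310` Greenberg LNM 1716 Prop. 3.10, `hGZ`
Gross–Zagier I.7.3, `hGZK` GZK, `hpar` modular parametrisation. No Greenberg–Vatsal parity (BOTH
ψ-parities), no partner / relative / twist, no anticyclotomic object, no `_OPEN` / preprint fact.

INSTRUMENTS (seat k5-c4 g9, `HOME/k5-c4-g9/`): `(μ, λ) = (0, 3)` two engines (planner engine B exact
modular symbols ‖ engine C hand-AFE, v4 exact Mazur–Tate element); `hordL` two legs (engine C c₁ ‖ engine B
vb1, conclusive rule `v < K − 1`); `v = ord_p Reg_p` two legs (engine H = this formula ‖ PARI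
`ellpadicheight·[1,−s₂]`, ratio `1 + O(p^35)`); `#tors`, `∏c_ℓ` Cremona `allbsd`. Candidates: 709 λ = 3
non-split cells @3 (371 ψ-even) + 16 @5.

What this is NOT: not a class theorem; not a booking; not the crux; cells with `Ш(E)[p] ≠ 0` are out of
reach of the inequality (they need a main-conjecture EQUALITY from elsewhere).
Refs: [GreenbergLNM1716] Prop. 3.10, §5 p. 183; [Wuthrich2014] Thm. 16; [SteinWuthrich2013] Thm. 6.1
(p. 20), §4.2; [Disegni2020] Thm. 4 (§3.2); [Miller2011LMS] Def. 1.1, Prop. 7.6; k5-c4 MEMO-6 §6 V9.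
-/

set_option autoImplicit false
set_option linter.dupNamespace false

noncomputable section

open scoped Classical MatrixGroups ModularForm

open WeierstrassCurve PowerSeries CongruenceSubgroup
  Literature.NumberTheory.EllipticCurves
  Literature.NumberTheory.EllipticCurves.ModularForms
  Literature.NumberTheory.EllipticCurves.Rank1Residual
  Literature.NumberTheory.EllipticCurves.Greenberg1999
  Literature.NumberTheory.EllipticCurves.Wuthrich2014
  Literature.NumberTheory.EllipticCurves.SteinWuthrich2013
  Literature.NumberTheory.EllipticCurves.Disegni2020
  Summit.BirchSwinnertonDyer.Rank1Residual
  Summit.BirchSwinnertonDyer.Rank1Residual.X2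

namespace Summit.BirchSwinnertonDyer.BirchSwinnertonDyer.Theorems.B11NonsplitRouteP

variable (W : WeierstrassCurve ℚ) [W.IsElliptic] [W.IsGloballyMinimal] (p : ℕ) [Fact p.Prime]

/-! ## §1 The composed door (any rational torsion) -/

/-- **X2c ∧ NON-split ∧ `(μ_an, λ_an) = (0, 3)` ∧ certified `ord_p Reg_p ≥ v` with
`1 + 2·ord_p #tors < v + ord_p ∏c_ℓ` ∧ `ord_{T=0} L_p = 1` ⟹ Mazur's main conjecture at the pair AND
`BSD(E,p)`** — both ψ-parities, no partner, no preprint. Route P at rank one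
(`X2.cellC_mazurMainConjectureAt_of_routeP`: Kato–Wuthrich divisibility + Greenberg's parity Prop. 3.10 +
Stein–Wuthrich Thm. 6.1) gives the main conjecture; `X2.bsdp_of_cellC_of_not_split_of_mazurMainConjectureAt_of_orderOne`
(Stein–Wuthrich Thm. 6.1 (2) + Disegni 2020 Thm. 4) gives `BSD(E,p)`. THE §4.2 heights exist by the tree
theorems `exists_isSplitMultCanonical_holds` / `exists_isMultCanonical_holds` (discharged inside).
[cite: GreenbergLNM1716, Prop. 3.10 and §5 p. 183] [cite: Wuthrich2014, Thm. 16 (p. 397)]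
[cite: SteinWuthrich2013, Thm. 6.1 (p. 20), §3.1 (p. 9), §4.2] [cite: Disegni2020, Thm. 4 (§3.2)]
[cite: Miller2011LMS, Def. 1.1 and Prop. 7.6] -/
theorem mazurMC_and_bsdp_of_cellC_of_not_split_of_routeP_of_orderOne
    (hDis : padicBSD_rankOne_nonsplitMult) (hWu : thm16_charIdeal_dvd_multiplicative_of_reducible)
    (hJs : thm61_splitMultiplicative) (hJn : thm61_nonsplitMultiplicative)
    (h310 : prop310_selmerCorank_mod_two_eq_lambdaInvariant)
    (hGZ : GrossZagier1986_thm_I_7_3) (hGZK : rank_eq_analyticRank_of_analyticRank_le_one)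
    (hpar : nonempty_modularParametrizationData)
    (hc : CellC W p) (hns : ¬ W.HasSplitMultiplicativeReductionAtPrime p)
    (hμ0 : AnalyticMuLE W p 0) (hlam3 : AnalyticLambdaEq W p 3) {v : ℤ}
    (hv : ∀ (q : ℚ_[p]) (Dh : PAdicHeightData W p), q ≠ 0 → ‖q‖ < 1 → tateJ q = (W.j : ℚ_[p]) →
      IsMultCanonical Dh q → padicRegulator Dh ≠ 0 → v ≤ (padicRegulator Dh).valuation)
    (hb : 1 + 2 * (padicValNat p W.torsionOrder : ℤ) < v + padicValNat p W.tamagawaProduct)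
    (hordL : ∀ {N : ℕ} [NeZero N] (f : CuspForm (Gamma0 N) 2), IsNewformOf W f →
      ∀ (ϖ : ℚ), (ϖ : ℝ) * W.realPeriodRat = plusPeriod f →
      ∀ L : PowerSeries ℚ_[p], IsMultPAdicLFunctionOf f p (-1) L → L.order = ((1 : ℕ) : ℕ∞)) :
    MazurMainConjectureAt W p ∧ BSDp W p := by
  have hMC : MazurMainConjectureAt W p :=
    cellC_mazurMainConjectureAt_of_routeP hWu hJs hJn exists_isSplitMultCanonical_holds
      exists_isMultCanonical_holds h310 hGZK W p hc hμ0 (fun _ ↦ hlam3) (fun _ ↦ ⟨v, hv, hb⟩)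
      (fun hs ↦ absurd hs hns) (fun hs ↦ absurd hs hns)
  exact ⟨hMC, bsdp_of_cellC_of_not_split_of_mazurMainConjectureAt_of_orderOne W p hDis hJn
    exists_isMultCanonical_holds hGZ hGZK hpar hc hns hMC hordL⟩

/-! ## §2 No rational `p`-torsion -/

/-- **The same door when `p ∤ #E(ℚ)_tors`** (the census norm on row B11): the inequality reads
`2 ≤ v + ord_p ∏c_ℓ` — e.g. `v ≥ 2`, or `v = 1 ∧ p ∣ ∏c_ℓ`, or `v = 0 ∧ p² ∣ ∏c_ℓ`.
[cite: GreenbergLNM1716, Prop. 3.10 and §5 p. 183] [cite: SteinWuthrich2013, Thm. 6.1 (p. 20), §4.2]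
[cite: Disegni2020, Thm. 4 (§3.2)] -/
theorem mazurMC_and_bsdp_of_cellC_of_not_split_of_routeP_of_orderOne_of_not_dvd_torsionOrder
    (hDis : padicBSD_rankOne_nonsplitMult) (hWu : thm16_charIdeal_dvd_multiplicative_of_reducible)
    (hJs : thm61_splitMultiplicative) (hJn : thm61_nonsplitMultiplicative)
    (h310 : prop310_selmerCorank_mod_two_eq_lambdaInvariant)
    (hGZ : GrossZagier1986_thm_I_7_3) (hGZK : rank_eq_analyticRank_of_analyticRank_le_one)
    (hpar : nonempty_modularParametrizationData)
    (hc : CellC W p) (hns : ¬ W.HasSplitMultiplicativeReductionAtPrime p)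
    (hμ0 : AnalyticMuLE W p 0) (hlam3 : AnalyticLambdaEq W p 3)
    (htors : ¬ p ∣ W.torsionOrder) {v : ℤ}
    (hv : ∀ (q : ℚ_[p]) (Dh : PAdicHeightData W p), q ≠ 0 → ‖q‖ < 1 → tateJ q = (W.j : ℚ_[p]) →
      IsMultCanonical Dh q → padicRegulator Dh ≠ 0 → v ≤ (padicRegulator Dh).valuation)
    (hb : 2 ≤ v + padicValNat p W.tamagawaProduct)
    (hordL : ∀ {N : ℕ} [NeZero N] (f : CuspForm (Gamma0 N) 2), IsNewformOf W f →
      ∀ (ϖ : ℚ), (ϖ : ℝ) * W.realPeriodRat = plusPeriod f →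
      ∀ L : PowerSeries ℚ_[p], IsMultPAdicLFunctionOf f p (-1) L → L.order = ((1 : ℕ) : ℕ∞)) :
    MazurMainConjectureAt W p ∧ BSDp W p := by
  have ht0 : padicValNat p W.torsionOrder = 0 := padicValNat.eq_zero_of_not_dvd htors
  refine mazurMC_and_bsdp_of_cellC_of_not_split_of_routeP_of_orderOne W p hDis hWu hJs hJn h310 hGZ
    hGZK hpar hc hns hμ0 hlam3 hv ?_ hordL
  rw [ht0, Nat.cast_zero, mul_zero, add_zero]
  linarith

/-! ## §3 The regulator road: route P ∘ Schneider — no `ord_{T=0}` reading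

Under Mazur's main conjecture at a non-split X2c pair the two per-pair certificates `ord_{T=0} L_p = 1`
and `Reg_p(E, Dh) ≠ 0` are EQUIVALENT (`X2.orderOne_iff_schneider_of_mazurMainConjectureAt_nonsplit`);
the height engine that certifies `v ≤ ord_p Reg_p` certifies `Reg_p ≠ 0` in the same reading (a
`p`-adic number computed to `p^40` with valuation `v`). So the `p`-adic `L`-function enters only through
`(μ_an, λ_an) = (0, 3)`: cc-typer-6's `X2.bsdp_of_cellC_of_not_split_of_mazurMainConjectureAt_of_schneider`
(O9) replaces the orderOne door. This reaches the cells whose `ord_{T=0}` certificate is inconclusive at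
every computed level (deep `[T¹]L_p`, e.g. `v_3 Reg_3 ≥ 4` on 6720l1, 9300c1, 14784r1). -/

/-- **X2c ∧ NON-split ∧ `(μ_an, λ_an) = (0, 3)` ∧ ONE height reading (`Reg_p ≠ 0` with `v ≤ ord_p Reg_p`
for every canonical §4.2 datum) ∧ `1 + 2·ord_p #tors < v + ord_p ∏c_ℓ` ⟹ Mazur's main conjecture at
the pair AND `BSD(E,p)`** — no `ord_{T=0}` reading, both ψ-parities, no partner, no preprint. Route P
(`X2.cellC_mazurMainConjectureAt_of_routeP`) for the main conjecture; O9's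
`X2.bsdp_of_cellC_of_not_split_of_mazurMainConjectureAt_of_schneider` (Stein–Wuthrich Thm. 6.1 +
Disegni 2020 Thm. 4) for `BSD(E,p)`. [cite: GreenbergLNM1716, Prop. 3.10 and §5 p. 183]
[cite: Wuthrich2014, Thm. 16 (p. 397)] [cite: SteinWuthrich2013, Thm. 6.1 (p. 20), §4.2]
[cite: Disegni2020, Thm. 4 (§3.2)] [cite: Miller2011LMS, Def. 1.1 and Prop. 7.6] -/
theorem mazurMC_and_bsdp_of_cellC_of_not_split_of_routeP_of_regulator
    (hDis : padicBSD_rankOne_nonsplitMult) (hWu : thm16_charIdeal_dvd_multiplicative_of_reducible)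
    (hJs : thm61_splitMultiplicative) (hJn : thm61_nonsplitMultiplicative)
    (h310 : prop310_selmerCorank_mod_two_eq_lambdaInvariant)
    (hGZ : GrossZagier1986_thm_I_7_3) (hGZK : rank_eq_analyticRank_of_analyticRank_le_one)
    (hpar : nonempty_modularParametrizationData)
    (hc : CellC W p) (hns : ¬ W.HasSplitMultiplicativeReductionAtPrime p)
    (hμ0 : AnalyticMuLE W p 0) (hlam3 : AnalyticLambdaEq W p 3) {v : ℤ}
    (hReg : ∀ (q : ℚ_[p]) (Dh : PAdicHeightData W p), q ≠ 0 → ‖q‖ < 1 → tateJ q = (W.j : ℚ_[p]) →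
      IsMultCanonical Dh q → padicRegulator Dh ≠ 0 ∧ v ≤ (padicRegulator Dh).valuation)
    (hb : 1 + 2 * (padicValNat p W.torsionOrder : ℤ) < v + padicValNat p W.tamagawaProduct) :
    MazurMainConjectureAt W p ∧ BSDp W p := by
  have hMC : MazurMainConjectureAt W p :=
    cellC_mazurMainConjectureAt_of_routeP hWu hJs hJn exists_isSplitMultCanonical_holds
      exists_isMultCanonical_holds h310 hGZK W p hc hμ0 (fun _ ↦ hlam3)
      (fun _ ↦ ⟨v, fun q Dh hq0 hq1 hqj hDh _ ↦ (hReg q Dh hq0 hq1 hqj hDh).2, hb⟩)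
      (fun hs ↦ absurd hs hns) (fun hs ↦ absurd hs hns)
  exact ⟨hMC, bsdp_of_cellC_of_not_split_of_mazurMainConjectureAt_of_schneider W p hDis hJn
    exists_isMultCanonical_holds hGZ hGZK hpar hc hns hMC
    (fun q Dh hq0 hq1 hqj hDh ↦ (hReg q Dh hq0 hq1 hqj hDh).1)⟩

/-- **The regulator road when `p ∤ #E(ℚ)_tors`**: `hb : 2 ≤ v + ord_p ∏c_ℓ`.
[cite: GreenbergLNM1716, Prop. 3.10 and §5 p. 183] [cite: SteinWuthrich2013, Thm. 6.1 (p. 20), §4.2]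
[cite: Disegni2020, Thm. 4 (§3.2)] -/
theorem mazurMC_and_bsdp_of_cellC_of_not_split_of_routeP_of_regulator_of_not_dvd_torsionOrder
    (hDis : padicBSD_rankOne_nonsplitMult) (hWu : thm16_charIdeal_dvd_multiplicative_of_reducible)
    (hJs : thm61_splitMultiplicative) (hJn : thm61_nonsplitMultiplicative)
    (h310 : prop310_selmerCorank_mod_two_eq_lambdaInvariant)
    (hGZ : GrossZagier1986_thm_I_7_3) (hGZK : rank_eq_analyticRank_of_analyticRank_le_one)
    (hpar : nonempty_modularParametrizationData)
    (hc : CellC W p) (hns : ¬ W.HasSplitMultiplicativeReductionAtPrime p)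
    (hμ0 : AnalyticMuLE W p 0) (hlam3 : AnalyticLambdaEq W p 3)
    (htors : ¬ p ∣ W.torsionOrder) {v : ℤ}
    (hReg : ∀ (q : ℚ_[p]) (Dh : PAdicHeightData W p), q ≠ 0 → ‖q‖ < 1 → tateJ q = (W.j : ℚ_[p]) →
      IsMultCanonical Dh q → padicRegulator Dh ≠ 0 ∧ v ≤ (padicRegulator Dh).valuation)
    (hb : 2 ≤ v + padicValNat p W.tamagawaProduct) :
    MazurMainConjectureAt W p ∧ BSDp W p := by
  have ht0 : padicValNat p W.torsionOrder = 0 := padicValNat.eq_zero_of_not_dvd htors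
  refine mazurMC_and_bsdp_of_cellC_of_not_split_of_routeP_of_regulator W p hDis hWu hJs hJn h310 hGZ
    hGZK hpar hc hns hμ0 hlam3 hReg ?_
  rw [ht0, Nat.cast_zero, mul_zero, add_zero]
  linarith

end Summit.BirchSwinnertonDyer.BirchSwinnertonDyer.Theorems.B11NonsplitRouteP

end
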